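import Summits.ResolutionOfSingularities.ResolutionOfSingularities.Theorems.HilbertSamuelEliminationSigmaMaxModificationsCorridor3SigmaMenuScheduler
import Summits.ResolutionOfSingularities.ResolutionOfSingularities.Theorems.HilbertSamuelEliminationSigmaMaxModificationsCorridor3SigmaMenuNonempty
import Summits.ResolutionOfSingularities.ResolutionOfSingularities.Theorems.HilbertSamuelEliminationSigmaMaxModificationsCorridor3SigmaHybridTopOfGroups
import HarnessLib

/-!
# [OURS · L1 W4.2] σ-LAYER — `Corridor3SigmaMenuTiers`: TIERED policies as NESTED HYBRIDS, the GROUP-SERVICE instance schema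
# `StrategyE.groupService γ Ω := oldestFirst (groupProposal γ Ω) (groupSiteKey γ)`, and the (D1) socket «THE OLDEST LIVE GROUP DIES»
# (exclusivity of group service + the scheme-free descent: older groups sealed + injective birth rank + progress under exclusive service ⇒ death)
# (res-L1-w42-plan-1 RULINGS v3.14-23 (FY)/(GA), -25 (GH) «o1 types `groupService γ Ω` + (D1)/(D2) sockets», -26 (GN), -27 (GQ) «tiers (P1) > (P2) >
# (P2′) > (P3) τ; p533524's machinery carries them»; crux chain w42 `SigmaMaxModifications` stmt-ResolutionOfSingularities-18506 / conjunct
# `SigmaMaxModificationsCorridor3` stmt-ResolutionOfSingularities-19249; typer res-L1-type-o1 (OURS typer G4); `--supports stmt-…-19249 --as helper`, counted 0)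

HONEST FRAMING. OURS design + proof bookkeeping over this typer's `…Corridor3SigmaMenuDiscipline` (p526241: `StrategyE.hybrid`, `IsDisciplinedBy[Over]`)
and `…Corridor3SigmaMenuScheduler` (p533524: `SiteProposal`, `SiteKey K`, `IsLiveSite`, `StrategyE.oldestFirst`). NOTHING here is a statement of
H. Hironaka's manuscript [Hironaka2017] nor of Cossart–Jannsen–Saito [CossartJannsenSaito2020]; no named fact is introduced; AI-typed, AI review is
weaker than expert review.

## What is here (namespace `…Theorems.SigmaMaxModificationsCorridor3.Sigma`)

* §1 **TIERS ARE NESTED HYBRIDS.** The scheduler of record (P1) surfaces > (P2) oldest group > (P2′) oldest partial-frame site > (P3) τ is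
  `π₁.hybrid (π₂.hybrid (π₂'.hybrid τ))` — first speaker wins (`StrategyE.hybrid`). New glue: `IsDisciplinedBy.hybrid₂` (two `M`-disciplined tiers give an
  `M`-disciplined hybrid), `IsDisciplinedByOver.hybrid_left` (a disciplined tier over a «disciplined-over-τ» tail is disciplined over τ),
  `hybrid_exists_step_iff` (the hybrid speaks iff some tier does); the NAME OF RECORD
  **`StrategyE.tiered π₁ π₂ π₃ τ`** with `IsFunctional.tiered`, `IsDisciplinedBy.tiered` (disciplined over `τ`), `IsDisciplinedBy.tiered_stepsOnlyWhileNonempty`,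
  `tiered_total`, **`isAdmissibleStrategyOnE_tiered`** (p526241's hybrid lemmas applied three times). All §1 lemmas are MENU-GENERIC (`M : CentreMenu`), so
  they apply verbatim to the discipline OF RECORD after RULING -32 (HF), `IsStratumDisciplined := IsDisciplinedBy stratumMenu` (p536950): e.g.
  `IsDisciplinedBy.tiered` at `M := stratumMenu` IS `IsStratumDisciplinedOver`, and `isAdmissibleStrategyOnE_tiered` takes `menuClauseA_stratum`.
* §2 **THE GROUP-SERVICE INSTANCE SCHEMA** (RULING -23 (FY)/(GA)): a GROUP READING `γ : GroupReading K` («the live cone at `x` belongs to the group with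
  key `k`», `none` off live cones; `K` = `ℕ ×ₗ ℕ` = (birth stage, birth index) per my WORD 13:37:59Z (3), ADOPTED -30 (GY)) and a GROUP ORACLE `Ω : GroupOracle K` («group `k`
  proposes `(C, P')`», the R2⁺ corner oracle of 060's B2 read scheme-side, `P' = none` per (FW) β); `groupProposal γ Ω : SiteProposal` (a cone point `x` of
  group `k` proposes `Ω`'s move for `k` when that move's centre passes through `x`), `groupSiteKey γ : SiteKey (WithTop K)`, and
  **`StrategyE.groupService γ Ω := oldestFirst (groupProposal γ Ω) (groupSiteKey γ)`** — functional (`groupService_isFunctional`), disciplined by any menu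
  containing the oracle's moves at their points (`groupService_isDisciplinedBy`), every step is the move of a live group through the served point
  (`groupService_step_spec`). NON-PREEMPTION («serve the oldest live group until it is dead») is not a clause: with an injective, time-constant key it is
  automatic for oldest-first (no older group is ever born, dead groups stay dead — hypothesis (SUB) below).
* §3 **THE (D1) SOCKET «THE OLDEST LIVE GROUP DIES» — DISCHARGED INTO res-D-pv-060's (E8-T) VOCABULARY** (`OldestLiveGroupDies`,
  `EveryGroupDiesAlong`, p536058; RULINGS -25 (GH), -30 (GY) shape of record). Scheduler half: **`groupService_step_of_exclusive`** (when `g` has a live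
  site and no live site has a smaller group key, every `groupService` step is `Ω`'s move for `g`). Descent half, scheme-free:
  **`eventually_forall_not_live_of_exclusive_progress`** — birth rank `β : ι → ℕ`, liveness `L g n`: (OLDER) older groups eventually dead for ever [060's
  antecedent], (FIN) finitely many older groups ever live along the chain [(G4)], (INJ) birth rank injective on groups ever live [the carrier's enumeration at
  birth], (SEAL) dead stays dead [(G2)], and while `g` is exclusive: (PROGRESS) `μ` drops at board-CHANGING steps [R2⁺ + E4c-S], (NEUTRAL) `μ` does not
  grow at board-neutral steps, (NOSTARVE) no infinite run of board-neutral steps [(E8-L)] ⇒ `g` eventually dead for ever. σ-reading: **`oldestLiveGroupDies_of`**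
  `: … → OldestLiveGroupDies σ N ν s₀ GLive β` and **`everyGroupDiesAlong_of`** (∘ 060's `everyGroupDiesAlong_of_oldestDies`).

VACUITY SELF-CHECK. §1/§2 are definitions, unfoldings and one-line consequences. §3's descent lemma is not vacuous: its antecedent is met by any finite
family of counters served oldest-first, and its conclusion fails without (PROGRESS)/(NOSTARVE) (a stalled oldest group lives for ever), without (FIN)/(OLDER)
(infinitely many older groups postpone `g` for ever) and without (INJ) (two same-rank groups could alternate).
-/

noncomputable section

set_option linter.dupNamespace false -- mandated namespace of this single-conjunct summit

open CategoryTheory AlgebraicGeometry TopologicalSpace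
open Summit.ResolutionOfSingularities.ResolutionOfSingularities.Theorems.CampaignW42
open Literature.AlgebraicGeometry.Resolution Literature.RingTheory.HilbertSamuel

namespace Summit.ResolutionOfSingularities.ResolutionOfSingularities.Theorems.SigmaMaxModificationsCorridor3.Sigma

universe u

/-! ## §1. Tiers are nested hybrids -/

section Tiers

variable {M : CentreMenu.{u}} {N : ℕ} {ν : ℕ → ℕ} {π₁ π₂ π₃ τ : StrategyE.{u}} {W : Scheme.{u}} {hW : IsLocallyNoetherian W} {L : Labelling W}
  {P : Option (Pending W)} {E : Boundary W}

/-- **Two `M`-disciplined tiers give an `M`-disciplined hybrid.** [folklore] -/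
theorem StrategyE.IsDisciplinedBy.hybrid₂ (h₁ : π₁.IsDisciplinedBy M N ν) (h₂ : π₂.IsDisciplinedBy M N ν) :
    (π₁.hybrid π₂).IsDisciplinedBy M N ν :=
  fun W hW L P E C P' h => (StrategyE.hybrid_step_cases h).elim (h₁ W hW L P E C P') (h₂ W hW L P E C P')

/-- **A disciplined tier over a tail that is disciplined over `τ` is disciplined over `τ`** (the (P2) > (P2′) > τ nesting). [folklore] -/
theorem StrategyE.IsDisciplinedByOver.hybrid_left (h₁ : π₁.IsDisciplinedBy M N ν) (h₂ : StrategyE.IsDisciplinedByOver M N ν τ π₂) :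
    StrategyE.IsDisciplinedByOver M N ν τ (π₁.hybrid π₂) :=
  fun W hW L P E C P' h => (StrategyE.hybrid_step_cases h).elim (fun h' => Or.inl (h₁ W hW L P E C P' h')) (h₂ W hW L P E C P')

/-- **The hybrid speaks iff some tier speaks.** [folklore] -/
theorem StrategyE.hybrid_exists_step_iff :
    (∃ (C : W.IdealSheafData) (P' : Option (Pending (blowup C))), (π₁.hybrid π₂).step W hW N ν L P E C P') ↔
      (∃ (C : W.IdealSheafData) (P' : Option (Pending (blowup C))), π₁.step W hW N ν L P E C P') ∨
        ∃ (C : W.IdealSheafData) (P' : Option (Pending (blowup C))), π₂.step W hW N ν L P E C P' := by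
  constructor
  · rintro ⟨C, P', h⟩
    exact (StrategyE.hybrid_step_cases h).imp (fun h' => ⟨C, P', h'⟩) fun h' => ⟨C, P', h'⟩
  · rintro (⟨C, P', h⟩ | ⟨C, P', h⟩)
    · exact ⟨C, P', StrategyE.hybrid_step_of_policy h⟩
    · by_cases hπ : ∃ (C₀ : W.IdealSheafData) (P₀ : Option (Pending (blowup C₀))), π₁.step W hW N ν L P E C₀ P₀
      · obtain ⟨C₀, P₀, h₀⟩ := hπ
        exact ⟨C₀, P₀, StrategyE.hybrid_step_of_policy h₀⟩
      · exact ⟨C, P', StrategyE.hybrid_step_of_fallback hπ h⟩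

/-- [OURS · L1 W4.2] **THE TIERED SCHEDULER OF RECORD** (CHAIN v3.19 §0r.3): (P1) `π₁` (surfaces first) > (P2) `π₂` (oldest group, `groupService`) >
(P2′) `π₃` (oldest partial-frame site) > (P3) the fallback `τ` (CJS canonical step) — the first tier that speaks decides the step. A NAME for the nested
hybrid; all its properties are the hybrid's, applied three times. NOT a statement of the manuscript. [folklore] -/
def StrategyE.tiered (π₁ π₂ π₃ τ : StrategyE.{u}) : StrategyE.{u} :=
  π₁.hybrid (π₂.hybrid (π₃.hybrid τ))

/-- Unfolding (`rfl`). [folklore] -/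
theorem StrategyE.tiered_eq (π₁ π₂ π₃ τ : StrategyE.{u}) : StrategyE.tiered π₁ π₂ π₃ τ = π₁.hybrid (π₂.hybrid (π₃.hybrid τ)) :=
  rfl

/-- **The tiered scheduler is FUNCTIONAL when its four components are.** [folklore] -/
theorem StrategyE.IsFunctional.tiered (h₁ : π₁.IsFunctional N ν) (h₂ : π₂.IsFunctional N ν) (h₃ : π₃.IsFunctional N ν) (hτ : τ.IsFunctional N ν) :
    (StrategyE.tiered π₁ π₂ π₃ τ).IsFunctional N ν :=
  h₁.hybrid (h₂.hybrid (h₃.hybrid hτ))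

/-- **The tiered scheduler is `M`-DISCIPLINED OVER ITS FALLBACK when the three tiers are `M`-disciplined** (so `IsMenuDisciplinedOver` for the Plus menu).
[folklore] -/
theorem StrategyE.IsDisciplinedBy.tiered (h₁ : π₁.IsDisciplinedBy M N ν) (h₂ : π₂.IsDisciplinedBy M N ν) (h₃ : π₃.IsDisciplinedBy M N ν)
    (τ : StrategyE.{u}) : StrategyE.IsDisciplinedByOver M N ν τ (StrategyE.tiered π₁ π₂ π₃ τ) :=
  StrategyE.IsDisciplinedByOver.hybrid_left h₁ (StrategyE.IsDisciplinedByOver.hybrid_left h₂ (h₃.hybrid τ))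

/-- **The tiered scheduler steps only while the stratum is non-empty** when the tiers are disciplined and the fallback does. [folklore] -/
theorem StrategyE.IsDisciplinedBy.tiered_stepsOnlyWhileNonempty (h₁ : π₁.IsDisciplinedBy M N ν) (h₂ : π₂.IsDisciplinedBy M N ν)
    (h₃ : π₃.IsDisciplinedBy M N ν) (hτ : τ.StepsOnlyWhileNonempty N ν) : (StrategyE.tiered π₁ π₂ π₃ τ).StepsOnlyWhileNonempty N ν :=
  (h₁.tiered h₂ h₃ τ).stepsOnlyWhileNonempty hτ

variable {𝒮 : StateScopeE.{u}}

/-- **The tiered scheduler is TOTAL on a scope as soon as the fallback is.** [folklore] -/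
theorem StrategyE.tiered_total
    (hτt : ∀ (W : Scheme.{u}) (hW : IsLocallyNoetherian W) (L : Labelling W) (P : Option (Pending W)) (E : Boundary W), 𝒮 W hW L P E →
      (Scheme.hsStratum W N ν).Nonempty → ∃ (C : W.IdealSheafData) (P' : Option (Pending (blowup C))), τ.step W hW N ν L P E C P') :
    ∀ (W : Scheme.{u}) (hW : IsLocallyNoetherian W) (L : Labelling W) (P : Option (Pending W)) (E : Boundary W), 𝒮 W hW L P E →
      (Scheme.hsStratum W N ν).Nonempty →
        ∃ (C : W.IdealSheafData) (P' : Option (Pending (blowup C))), (StrategyE.tiered π₁ π₂ π₃ τ).step W hW N ν L P E C P' :=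
  StrategyE.hybrid_total (StrategyE.hybrid_total (StrategyE.hybrid_total hτt))

/-- **SCOPED ADMISSIBILITY OF THE TIERED SCHEDULER**: three `M`-disciplined tiers over a fallback with clause (a) and totality on the scope, plus
`MenuClauseA M` on the scope ⇒ `IsAdmissibleStrategyOnE 𝒮 N ν (tiered π₁ π₂ π₃ τ)` (for the Plus menu on good scopes: `menuClauseA_plus`).
[cite: CossartJannsenSaito2020, Def. 3.1, Rem. 6.29 (1)] -/
theorem isAdmissibleStrategyOnE_tiered (h₁ : π₁.IsDisciplinedBy M N ν) (h₂ : π₂.IsDisciplinedBy M N ν) (h₃ : π₃.IsDisciplinedBy M N ν)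
    (hM : MenuClauseA M N ν 𝒮)
    (hτa : ∀ (W : Scheme.{u}) (hW : IsLocallyNoetherian W) (L : Labelling W) (P : Option (Pending W)) (E : Boundary W), 𝒮 W hW L P E →
      ∀ (C : W.IdealSheafData) (P' : Option (Pending (blowup C))), τ.step W hW N ν L P E C P' →
        IdealSheafData.IsPermissible C ∧ (C.support : Set W) ⊆ Scheme.hsStratum W N ν ∧
          ((Scheme.hsStratum W N ν).Nonempty → (C.support : Set W).Nonempty))
    (hτt : ∀ (W : Scheme.{u}) (hW : IsLocallyNoetherian W) (L : Labelling W) (P : Option (Pending W)) (E : Boundary W), 𝒮 W hW L P E →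
      (Scheme.hsStratum W N ν).Nonempty → ∃ (C : W.IdealSheafData) (P' : Option (Pending (blowup C))), τ.step W hW N ν L P E C P') :
    IsAdmissibleStrategyOnE 𝒮 N ν (StrategyE.tiered π₁ π₂ π₃ τ) :=
  isAdmissibleStrategyOnE_of_disciplinedByOver (h₁.tiered h₂ h₃ τ) hM hτa (StrategyE.tiered_total hτt)

end Tiers

/-! ## §2. The group-service instance schema -/

/-- [OURS · L1 W4.2] **A GROUP READING** with keys in `K`: «the point `x` is a live cone of the group with key `k`» (`some k`), or not a live cone
(`none`). Instance (060/064's per-group run carrier): `K = ℕ ×ₗ ℕ`, key = (birth stage, birth index), inherited by descendant cones. [folklore] -/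
abbrev GroupReading (K : Type) : Type (u + 1) :=
  ∀ (W : Scheme.{u}), IsLocallyNoetherian W → ℕ → (ℕ → ℕ) → Labelling W → Option (Pending W) → Boundary W → W → Option K

/-- [OURS · L1 W4.2] **A GROUP ORACLE**: «at the state, the group with key `k` proposes the step `(C, P')`» (instance: the R2⁺ corner oracle of the group's
puzzle, read scheme-side, `P' = none`). [folklore] -/
abbrev GroupOracle (K : Type) : Type (u + 1) :=
  ∀ (W : Scheme.{u}), IsLocallyNoetherian W → ℕ → (ℕ → ℕ) → Labelling W → Option (Pending W) → Boundary W → K →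
    (C : W.IdealSheafData) → Option (Pending (blowup C)) → Prop

section Groups

variable {K : Type}

/-- [OURS · L1 W4.2] **THE GROUP PROPOSAL RELATION**: the live cone `x` of group `k` proposes `Ω`'s move for `k` when that move's centre passes through `x`
(so the proposal is keyed at a point OF the face it blows up — the menu discipline reads the menu at that point). [folklore] -/
def groupProposal (γ : GroupReading.{u} K) (Ω : GroupOracle.{u} K) : SiteProposal.{u} :=
  fun W hW N ν L P E x C P' => ∃ k : K, γ W hW N ν L P E x = some k ∧ Ω W hW N ν L P E k C P' ∧ x ∈ (C.support : Set W)

/-- [OURS · L1 W4.2] **THE GROUP SITE KEY**: the key of the group of the live cone `x` (`⊤` off live cones, never chosen while a cone is live). [folklore] -/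
def groupSiteKey (γ : GroupReading.{u} K) : SiteKey.{u} (WithTop K) :=
  fun W hW N ν L P E x => (γ W hW N ν L P E x).elim ⊤ WithTop.some

/-- [OURS · L1 W4.2] **GROUP SERVICE — the (P2) tier of the scheduler of record** (RULINGS v3.14-23 (FY)/(GA)): OLDEST-SITE-FIRST over the group proposals
with the group key — serve the move of the OLDEST live group, ties impossible for an injective key; functional; silent iff no live group proposes.
NOT a statement of the manuscript. [folklore] -/
def StrategyE.groupService [LE K] (γ : GroupReading.{u} K) (Ω : GroupOracle.{u} K) : StrategyE.{u} :=
  StrategyE.oldestFirst (groupProposal γ Ω) (groupSiteKey γ)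

variable {γ : GroupReading.{u} K} {Ω : GroupOracle.{u} K} {N : ℕ} {ν : ℕ → ℕ}

/-- The group key at a live cone. [folklore] -/
theorem groupSiteKey_of_eq_some {W : Scheme.{u}} {hW : IsLocallyNoetherian W} {L : Labelling W} {P : Option (Pending W)} {E : Boundary W}
    {x : W} {k : K} (h : γ W hW N ν L P E x = some k) : groupSiteKey γ W hW N ν L P E x = (k : WithTop K) := by
  simp [groupSiteKey, h]

/-- (T4) for group proposals: they pass through their site, by construction. [folklore] -/
theorem groupProposal_mem_support {W : Scheme.{u}} {hW : IsLocallyNoetherian W} {L : Labelling W} {P : Option (Pending W)} {E : Boundary W}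
    {x : W} {C : W.IdealSheafData} {P' : Option (Pending (blowup C))} (h : groupProposal γ Ω W hW N ν L P E x C P') :
    x ∈ (C.support : Set W) :=
  let ⟨_, _, _, hx⟩ := h
  hx

variable [LE K]

/-- Unfolding (`rfl`). [folklore] -/
theorem StrategyE.groupService_eq (γ : GroupReading.{u} K) (Ω : GroupOracle.{u} K) :
    StrategyE.groupService γ Ω = StrategyE.oldestFirst (groupProposal γ Ω) (groupSiteKey γ) :=
  rfl

/-- **Group service is FUNCTIONAL.** [folklore] -/
theorem StrategyE.groupService_isFunctional (γ : GroupReading.{u} K) (Ω : GroupOracle.{u} K) (N : ℕ) (ν : ℕ → ℕ) :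
    (StrategyE.groupService γ Ω).IsFunctional N ν :=
  StrategyE.oldestFirst_isFunctional _ _ N ν

/-- **Every step of group service is a live group's move through the served stratum point.** [folklore] -/
theorem StrategyE.groupService_step_spec {W : Scheme.{u}} {hW : IsLocallyNoetherian W} {L : Labelling W} {P : Option (Pending W)}
    {E : Boundary W} {C : W.IdealSheafData} {P' : Option (Pending (blowup C))}
    (hs : (StrategyE.groupService γ Ω).step W hW N ν L P E C P') :
    ∃ (x : W) (k : K), x ∈ Scheme.hsStratum W N ν ∧ γ W hW N ν L P E x = some k ∧ Ω W hW N ν L P E k C P' ∧ x ∈ (C.support : Set W) := by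
  obtain ⟨x, ⟨⟨hx, -⟩, -⟩, k, hk, hΩ, hxC⟩ := StrategyE.oldestFirst_step_spec hs
  exact ⟨x, k, hx, hk, hΩ, hxC⟩

/-- **Group service is DISCIPLINED by any menu containing the oracle's moves at the points they pass through.** [folklore] -/
theorem StrategyE.groupService_isDisciplinedBy {M : CentreMenu.{u}}
    (hΩ : ∀ (W : Scheme.{u}) (hW : IsLocallyNoetherian W) (L : Labelling W) (P : Option (Pending W)) (E : Boundary W) (x : W) (k : K)
      (C : W.IdealSheafData) (P' : Option (Pending (blowup C))),
      x ∈ Scheme.hsStratum W N ν → γ W hW N ν L P E x = some k → Ω W hW N ν L P E k C P' → x ∈ (C.support : Set W) → M W E N ν x C) :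
    (StrategyE.groupService γ Ω).IsDisciplinedBy M N ν :=
  StrategyE.oldestFirst_isDisciplinedBy fun W hW L P E x C P' hx ⟨k, hk, hΩk, hxC⟩ => hΩ W hW L P E x k C P' hx hk hΩk hxC

end Groups

/-! ## §3. The (D1) socket: the oldest live group dies — exclusivity of group service, and the scheme-free descent -/

section Exclusive

variable {K : Type} [LinearOrder K] {γ : GroupReading.{u} K} {Ω : GroupOracle.{u} K} {N : ℕ} {ν : ℕ → ℕ}

/-- **EXCLUSIVITY OF GROUP SERVICE**: at a state where the group `g` has a live site and NO live site belongs to a group with a smaller key, every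
step of `groupService γ Ω` is `Ω`'s move FOR `g`, through a stratum cone point of `g` (oldest-first serves a least key; the least key is `g`'s).
This is the scheduler half of (D1) «once every older group is dead, `g` is served exclusively»; the rank half (R2⁺ progress) is the instance's.
[folklore] -/
theorem StrategyE.groupService_step_of_exclusive {W : Scheme.{u}} {hW : IsLocallyNoetherian W} {L : Labelling W} {P : Option (Pending W)}
    {E : Boundary W} {C : W.IdealSheafData} {P' : Option (Pending (blowup C))} (hs : (StrategyE.groupService γ Ω).step W hW N ν L P E C P')
    {g : K} (hg : ∃ x : W, IsLiveSite (groupProposal γ Ω) W hW N ν L P E x ∧ γ W hW N ν L P E x = some g)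
    (hexcl : ∀ (x : W) (k : K), IsLiveSite (groupProposal γ Ω) W hW N ν L P E x → γ W hW N ν L P E x = some k → g ≤ k) :
    ∃ x : W, x ∈ Scheme.hsStratum W N ν ∧ γ W hW N ν L P E x = some g ∧ Ω W hW N ν L P E g C P' ∧ x ∈ (C.support : Set W) := by
  obtain ⟨x, ⟨hxlive, hxmin⟩, k, hk, hΩ, hxC⟩ := StrategyE.oldestFirst_step_spec hs
  obtain ⟨y, hylive, hyg⟩ := hg
  have hle : (k : WithTop K) ≤ (g : WithTop K) := by
    have := hxmin y hylive
    rwa [groupSiteKey_of_eq_some hk, groupSiteKey_of_eq_some hyg] at this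
  have hge : g ≤ k := hexcl x k hxlive hk
  have hkg : k = g := le_antisymm (WithTop.coe_le_coe.mp hle) hge
  subst hkg
  exact ⟨x, hxlive.1, hk, hΩ, hxC⟩

end Exclusive

section Descent

/-- **EVENTUAL SEALED DEATH UNDER EXCLUSIVE PROGRESS — the scheme-free core of (D1)**, in the SHAPE OF RECORD of RULING v3.14-30 (GY) (res-D-pv-060's
(E8-T) socket `OldestLiveGroupDies`, whose antecedent «every OLDER group is eventually dead for ever along the chain» is `holder`). Groups `ι` with an
ℕ-valued BIRTH RANK `β`, liveness `L g n` along a chain, a rank `μ`, and the steps that CHANGE `g`'s boards: if (OLDER) every group of smaller birth rank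
is eventually dead for ever, (FIN) only finitely many groups of smaller birth rank are EVER live along the chain, (INJ) the birth rank is injective on groups
ever live, (SEAL) a group that has lived and is dead stays dead, and — while `g` is live and EXCLUSIVE (no other group of birth rank `≤ β g` is live) —
(PROGRESS) `μ` drops strictly at every board-changing step, (NEUTRAL) `μ` does not grow at the other steps, (NOSTARVE) there is no infinite run of
consecutive board-neutral steps, THEN `g` is eventually dead for ever. [folklore] -/
theorem eventually_forall_not_live_of_exclusive_progress {ι : Type*} {L : ι → ℕ → Prop} {β : ι → ℕ} {μ : ℕ → ι → ℕ}
    {changes : ℕ → Prop} {g : ι}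
    (holder : ∀ g', β g' < β g → ∃ n₂, ∀ n, n₂ ≤ n → ¬ L g' n)
    (hfin : {g' | β g' < β g ∧ ∃ n, L g' n}.Finite)
    (hinj : ∀ g', (∃ n, L g' n) → β g' = β g → g' = g)
    (hseal : ∀ n, (∃ m, m ≤ n ∧ L g m) → ¬ L g n → ¬ L g (n + 1))
    (hprog : ∀ n, (∀ g', g' ≠ g → β g' ≤ β g → ¬ L g' n) → L g n → L g (n + 1) → changes n → μ (n + 1) g < μ n g)
    (hneut : ∀ n, (∀ g', g' ≠ g → β g' ≤ β g → ¬ L g' n) → L g n → L g (n + 1) → ¬ changes n → μ (n + 1) g ≤ μ n g)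
    (hnostarve : ∀ n₀, ¬ ∀ n, n₀ ≤ n → (∀ g', g' ≠ g → β g' ≤ β g → ¬ L g' n) ∧ L g n ∧ ¬ changes n) :
    ∃ n₂, ∀ n, n₂ ≤ n → ¬ L g n := by
  classical
  -- a stage beyond which `g` is exclusive: every older group that is ever live is dead for ever, and no OTHER group has the same rank
  have holder' : ∀ g' : ι, ∃ n₂, β g' < β g → ∀ n, n₂ ≤ n → ¬ L g' n := fun g' => by
    by_cases h : β g' < β g
    · obtain ⟨n₂, hn₂⟩ := holder g' h
      exact ⟨n₂, fun _ => hn₂⟩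
    · exact ⟨0, fun h' => absurd h' h⟩
  choose T hT using holder'
  obtain ⟨n₁, hn₁⟩ : ∃ n₁, ∀ n, n₁ ≤ n → ∀ g', g' ≠ g → β g' ≤ β g → ¬ L g' n := by
    refine ⟨hfin.toFinset.sup T, fun n hn g' hne hle hL => ?_⟩
    rcases hle.lt_or_eq with hlt | heq
    · exact hT g' hlt n ((Finset.le_sup (hfin.mem_toFinset.mpr ⟨hlt, n, hL⟩)).trans hn) hL
    · exact hne (hinj g' ⟨n, hL⟩ heq)
  -- if `g` is never live there is nothing to do
  by_cases hever : ∃ m, L g m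
  swap
  · exact ⟨0, fun n _ hL => hever ⟨n, hL⟩⟩
  obtain ⟨m₀, hm₀⟩ := hever
  set n₂ := max n₁ m₀ with hn₂
  -- `g` cannot be live at every stage from `n₂` on: its rank never grows and drops at the infinitely many board-changing steps
  have hdead : ∃ n, n₂ ≤ n ∧ ¬ L g n := by
    by_contra! hlive
    set a : ℕ → ℕ := fun i => μ (n₂ + i) g with ha
    have hexcl : ∀ i, ∀ g', g' ≠ g → β g' ≤ β g → ¬ L g' (n₂ + i) := fun i => hn₁ _ ((le_max_left _ _).trans (Nat.le_add_right _ _))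
    have hL : ∀ i, L g (n₂ + i) := fun i => hlive _ (Nat.le_add_right _ _)
    have hstep : ∀ i, a (i + 1) ≤ a i := fun i => by
      by_cases hc : changes (n₂ + i)
      · exact (hprog _ (hexcl i) (hL i) (hL (i + 1)) hc).le
      · exact hneut _ (hexcl i) (hL i) (hL (i + 1)) hc
    have hanti : Antitone a := antitone_nat_of_succ_le hstep
    -- beyond every index there is a board-changing step
    have hchange : ∀ i, ∃ j, i ≤ j ∧ a (j + 1) < a j := fun i => by
      by_contra! hno
      refine hnostarve (n₂ + i) fun n hn => ⟨hn₁ n ((le_max_left _ _).trans ((Nat.le_add_right _ _).trans hn)), hlive n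
        ((Nat.le_add_right _ _).trans hn), fun hc => ?_⟩
      obtain ⟨d, rfl⟩ := Nat.exists_eq_add_of_le hn
      have hlt := hprog _ (hexcl (i + d)) (hL (i + d)) (hL (i + d + 1)) (by simpa [Nat.add_assoc] using hc)
      have := hno (i + d) (Nat.le_add_right _ _)
      simp only [ha, Nat.add_assoc] at this hlt
      omega
    have hsum : ∀ k, ∃ i, a i + k ≤ a 0 := fun k => by
      induction k with
      | zero => exact ⟨0, by simp⟩
      | succ k ih =>
        obtain ⟨i, hi⟩ := ih
        obtain ⟨j, hij, hj⟩ := hchange i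
        exact ⟨j + 1, by have := hanti hij; omega⟩
    obtain ⟨i, hi⟩ := hsum (a 0 + 1)
    omega
  -- once dead (having lived), dead for ever
  obtain ⟨n, hn, hdn⟩ := hdead
  refine ⟨n, fun k hk => ?_⟩
  induction hk with
  | refl => exact hdn
  | step hle ih => exact hseal _ ⟨m₀, (le_max_right _ _ |>.trans hn).trans hle, hm₀⟩ ih

variable {ι : Type} {σ : StrategyE.{u}} {N : ℕ} {ν : ℕ → ℕ} {s₀ : MarkedStageE.{u}} {GLive : ι → MarkedStageE.{u} → Prop} {β : ι → ℕ}

/-- **THE (D1) SOCKET OF res-D-pv-060's (E8-T) CLOSED FROM THE INSTANCES' INPUTS**: `OldestLiveGroupDies σ N ν s₀ GLive β` (p536058) holds as soon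
as, along every σE-chain `c` from `s₀` and for every group `g`, (FIN) finitely many OLDER groups are ever live [(G4) × finitely many birth stages],
(INJ) the birth rank is injective on groups ever live [the carrier's enumeration at birth], (SEAL) dead stays dead [(G2)], and while `g` is the EXCLUSIVE
live group (every `groupService` step is then `Ω`'s move for `g`: `groupService_step_of_exclusive`): (PROGRESS) a stage-read rank `μ` drops at every
step that CHANGES `g`'s boards [R2⁺ + E4c-S; board-changing = `Ω_g`'s moves and (P1) singletons through `g`'s cones, RULING -30 (GY)], (NEUTRAL) `μ` does
not grow at board-neutral steps, (NOSTARVE) no infinite run of board-neutral steps [(E8-L)]. [folklore] -/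
theorem oldestLiveGroupDies_of (μ : MarkedStageE.{u} → ι → ℕ) (changes : (ℕ → MarkedStageE.{u}) → ι → ℕ → Prop)
    (hfin : ∀ c, IsChainFromσE σ N ν s₀ c → ∀ g : ι, {g' | β g' < β g ∧ ∃ n, GLive g' (c n)}.Finite)
    (hinj : ∀ c, IsChainFromσE σ N ν s₀ c → ∀ g g' : ι, (∃ n, GLive g' (c n)) → β g' = β g → g' = g)
    (hseal : ∀ c, IsChainFromσE σ N ν s₀ c → ∀ (g : ι) (n : ℕ), (∃ m, m ≤ n ∧ GLive g (c m)) → ¬ GLive g (c n) → ¬ GLive g (c (n + 1)))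
    (hprog : ∀ c, IsChainFromσE σ N ν s₀ c → ∀ (g : ι) (n : ℕ), (∀ g', g' ≠ g → β g' ≤ β g → ¬ GLive g' (c n)) →
      GLive g (c n) → GLive g (c (n + 1)) → changes c g n → μ (c (n + 1)) g < μ (c n) g)
    (hneut : ∀ c, IsChainFromσE σ N ν s₀ c → ∀ (g : ι) (n : ℕ), (∀ g', g' ≠ g → β g' ≤ β g → ¬ GLive g' (c n)) →
      GLive g (c n) → GLive g (c (n + 1)) → ¬ changes c g n → μ (c (n + 1)) g ≤ μ (c n) g)
    (hnostarve : ∀ c, IsChainFromσE σ N ν s₀ c → ∀ (g : ι) (n₀ : ℕ),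
      ¬ ∀ n, n₀ ≤ n → (∀ g', g' ≠ g → β g' ≤ β g → ¬ GLive g' (c n)) ∧ GLive g (c n) ∧ ¬ changes c g n) :
    OldestLiveGroupDies σ N ν s₀ GLive β :=
  fun c hc g holder =>
    eventually_forall_not_live_of_exclusive_progress (L := fun g n => GLive g (c n)) (μ := fun n g => μ (c n) g) (changes := changes c g)
      holder (hfin c hc g) (hinj c hc g) (hseal c hc g) (hprog c hc g) (hneut c hc g) (hnostarve c hc g)

/-- **… hence (D2) `EveryGroupDiesAlong`** by 060's induction on the birth rank (`everyGroupDiesAlong_of_oldestDies`). [folklore] -/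
theorem everyGroupDiesAlong_of (μ : MarkedStageE.{u} → ι → ℕ) (changes : (ℕ → MarkedStageE.{u}) → ι → ℕ → Prop)
    (hfin : ∀ c, IsChainFromσE σ N ν s₀ c → ∀ g : ι, {g' | β g' < β g ∧ ∃ n, GLive g' (c n)}.Finite)
    (hinj : ∀ c, IsChainFromσE σ N ν s₀ c → ∀ g g' : ι, (∃ n, GLive g' (c n)) → β g' = β g → g' = g)
    (hseal : ∀ c, IsChainFromσE σ N ν s₀ c → ∀ (g : ι) (n : ℕ), (∃ m, m ≤ n ∧ GLive g (c m)) → ¬ GLive g (c n) → ¬ GLive g (c (n + 1)))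
    (hprog : ∀ c, IsChainFromσE σ N ν s₀ c → ∀ (g : ι) (n : ℕ), (∀ g', g' ≠ g → β g' ≤ β g → ¬ GLive g' (c n)) →
      GLive g (c n) → GLive g (c (n + 1)) → changes c g n → μ (c (n + 1)) g < μ (c n) g)
    (hneut : ∀ c, IsChainFromσE σ N ν s₀ c → ∀ (g : ι) (n : ℕ), (∀ g', g' ≠ g → β g' ≤ β g → ¬ GLive g' (c n)) →
      GLive g (c n) → GLive g (c (n + 1)) → ¬ changes c g n → μ (c (n + 1)) g ≤ μ (c n) g)
    (hnostarve : ∀ c, IsChainFromσE σ N ν s₀ c → ∀ (g : ι) (n₀ : ℕ),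
      ¬ ∀ n, n₀ ≤ n → (∀ g', g' ≠ g → β g' ≤ β g → ¬ GLive g' (c n)) ∧ GLive g (c n) ∧ ¬ changes c g n) :
    EveryGroupDiesAlong σ N ν s₀ GLive :=
  everyGroupDiesAlong_of_oldestDies β (oldestLiveGroupDies_of μ changes hfin hinj hseal hprog hneut hnostarve)

end Descent

end Summit.ResolutionOfSingularities.ResolutionOfSingularities.Theorems.SigmaMaxModificationsCorridor3.Sigma

end
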